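import Summits.NavierStokesRegularity.NavierStokesRegularity.Theorems.SqueezeCycleSingularProfileOfNontrivialModelClass
import Literature.Analysis.FluidPDE.ClassicalSuitable
import Literature.Analysis.FluidPDE.EnstrophyGronwall

/-!
# Route SqueezeCycle · item `SingularProfileOfNontrivial` (stmt-NavierStokesRegularity-15368):
# `A ≤ C`, `C ≤ 2C²`, `E ≤ 3C` on the unit parabolic ball for a class member

Helper file (theorems only). For `u` in 𝒦_C (`IsTypeIAncientMild C u` + scaled-energy clause) and
`∇u := fderiv`, Albritton–Barker's scaled quantities on `Q(0,1)` obey `A ≤ C` (the clause),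
`C ≤ 2C²` (rate × local energy and `∫_{(−1,0)}(−t)^{−1/2} = 2`), `E ≤ 3C` (Frobenius ≤ 3 × operator norm;
the time integral up to `t = 0` by monotone convergence from the balls `Q((tₙ,0),1)`, `tₙ ↑ 0`, on which the
clause is a genuine integral).

References: T. Tao, Anal. PDE 6 (2013), §4, proof of Lemma 4.1 (i) [Tao2011]; D. Albritton, T. Barker,
J. Math. Fluid Mech. 21 (2019) = arXiv:1811.00502, §1, §3 [AlbrittonBarker2019]; G. Koch, N. Nadirashvili,
G. Seregin, V. Šverák, Acta Math. 203 (2009) [KochNadirashviliSereginSverak2009].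
-/

noncomputable section

-- the sub-problem namespace repeats the summit name (D-0017 layout `Summit.<S>.<P>.Theorems`)
set_option linter.dupNamespace false
-- nested operator types `ℝ³ →L[ℝ] ℝ³ →L[ℝ] ℝ³ →L[ℝ] ℝ` (pressure kernels)
set_option maxSynthPendingDepth 3

namespace Summit.NavierStokesRegularity.NavierStokesRegularity.Theorems.SingularProfile

open MeasureTheory Set Filter Metric Function
open _root_.Topology
open scoped ENNReal NNReal Laplacian ContDiff RealInnerProductSpace
open Literature.Analysis.FluidPDE
open Literature.Analysis.FluidPDE.FourierNS (HasDecay)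

variable {C : ℝ} {u : ℝ → (EuclideanSpace ℝ (Fin 3)) → (EuclideanSpace ℝ (Fin 3))}
  {q : ℝ → (EuclideanSpace ℝ (Fin 3)) → ℝ}

/-- **`A(Q(0,1)) ≤ C`** for a class member. [cite: AlbrittonBarker2019, §1] -/
theorem cknAEss_unit_le (hK : IsTypeIAncientMild C u)
    (h5 : ∀ (x₀ : EuclideanSpace ℝ (Fin 3)) (t₀ r : ℝ), t₀ ≤ 0 → 0 < r →
      (∀ t, t₀ - r ^ 2 < t → t < t₀ → r⁻¹ * ∫ x in ball x₀ r, ‖u t x‖ ^ 2 ≤ C) ∧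
        r⁻¹ * ∫ t in Ioo (t₀ - r ^ 2) t₀, ∫ x in ball x₀ r, ‖fderiv ℝ (u t) x‖ ^ 2 ≤ C) :
    cknAEss 1 0 u ≤ ENNReal.ofReal C := by
  unfold cknAEss
  refine essSup_le_of_ae_le _ ?_
  refine (ae_restrict_mem measurableSet_Ioo).mono fun t ht => ?_
  simp only [Prod.fst_zero, Prod.snd_zero, one_pow, zero_sub, mem_Ioo] at ht ⊢
  have ht0 : t < 0 := ht.2
  have h := (h5 0 0 1 le_rfl one_pos).1 t (by linarith [ht.1]) ht0
  rw [inv_one, one_mul] at h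
  rw [ENNReal.ofReal_one, inv_one, one_mul, lintegral_ball_enorm_sq_eq (hK.continuous_slice ht0)]
  exact ENNReal.ofReal_le_ofReal h

/-- The cube of a Type-I slice against its local energy:
`∫_{B(x₀,r)} |u(t)|³ ≤ C(−t)^{−1/2} ∫_{B(x₀,r)} |u(t)|²` (`ℝ≥0∞` form). [cite: KNSS2009, (1.4)] -/
theorem lintegral_ball_cube_le (hK : IsTypeIAncientMild C u) {t : ℝ} (ht : t < 0)
    (x₀ : EuclideanSpace ℝ (Fin 3)) (r : ℝ) :
    ∫⁻ x in ball x₀ r, ‖u t x‖ₑ ^ (3 : ℕ) ≤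
      ENNReal.ofReal (C * (-t) ^ (-(2⁻¹ : ℝ))) * ∫⁻ x in ball x₀ r, ‖u t x‖ₑ ^ 2 := by
  rw [← lintegral_const_mul' _ _ ENNReal.ofReal_ne_top]
  refine lintegral_mono fun x => ?_
  have hb : ‖u t x‖ ≤ C * (-t) ^ (-(2⁻¹ : ℝ)) := by
    have h := hK.norm_le ht x
    rwa [Real.sqrt_eq_rpow, div_eq_mul_inv, ← Real.rpow_neg (neg_nonneg.2 ht.le),
      show -((1 : ℝ) / 2) = -(2⁻¹ : ℝ) by norm_num] at h
  calc ‖u t x‖ₑ ^ (3 : ℕ) = ‖u t x‖ₑ * ‖u t x‖ₑ ^ 2 := by ring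
    _ ≤ ENNReal.ofReal (C * (-t) ^ (-(2⁻¹ : ℝ))) * ‖u t x‖ₑ ^ 2 := by
        gcongr
        rw [← ofReal_norm]
        exact ENNReal.ofReal_le_ofReal hb

/-- **`C(Q(0,1)) ≤ 2C²`** for a class member (rate × local energy, and
`∫_{(−1,0)} (−t)^{−1/2} dt = 2`). [cite: AlbrittonBarker2019, §1] -/
theorem cknC_unit_le (hK : IsTypeIAncientMild C u)
    (h5 : ∀ (x₀ : EuclideanSpace ℝ (Fin 3)) (t₀ r : ℝ), t₀ ≤ 0 → 0 < r →
      (∀ t, t₀ - r ^ 2 < t → t < t₀ → r⁻¹ * ∫ x in ball x₀ r, ‖u t x‖ ^ 2 ≤ C) ∧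
        r⁻¹ * ∫ t in Ioo (t₀ - r ^ 2) t₀, ∫ x in ball x₀ r, ‖fderiv ℝ (u t) x‖ ^ 2 ≤ C) :
    cknC 1 0 u ≤ ENNReal.ofReal (2 * C ^ 2) := by
  have hC0 := hK.nonneg
  unfold cknC
  rw [ENNReal.ofReal_one, one_pow, inv_one, one_mul]
  have hF : AEMeasurable (fun w : ℝ × EuclideanSpace ℝ (Fin 3) => ‖u w.1 w.2‖ₑ ^ (3 : ℕ))
      (volume.restrict (parabolicCylinder 1 (0 : ℝ × EuclideanSpace ℝ (Fin 3)))) :=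
    aemeasurable_parabolicCylinder_one_of_continuousOn
      ((ENNReal.continuous_pow 3).comp_continuousOn
        (continuous_enorm.comp_continuousOn hK.continuousOn_uncurry))
  rw [lintegral_parabolicCylinder_one_eq hF]
  -- slice bound
  have hslice : ∀ t ∈ Ioo (-1 : ℝ) 0, ∫⁻ x in ball (0 : EuclideanSpace ℝ (Fin 3)) 1, ‖u t x‖ₑ ^ (3 : ℕ) ≤
      ENNReal.ofReal (C ^ 2) * ENNReal.ofReal ((-t) ^ (-(2⁻¹ : ℝ))) := by
    intro t ht
    have ht0 : t < 0 := ht.2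
    have hA := (h5 0 0 1 le_rfl one_pos).1 t (by linarith [ht.1]) ht0
    rw [inv_one, one_mul] at hA
    refine (lintegral_ball_cube_le hK ht0 0 1).trans ?_
    have hpow : 0 ≤ (-t) ^ (-(2⁻¹ : ℝ)) := Real.rpow_nonneg (by linarith) _
    rw [lintegral_ball_enorm_sq_eq (hK.continuous_slice ht0),
      ← ENNReal.ofReal_mul (mul_nonneg hC0 hpow), ← ENNReal.ofReal_mul (sq_nonneg C)]
    refine ENNReal.ofReal_le_ofReal ?_
    calc C * (-t) ^ (-(2⁻¹ : ℝ)) * ∫ x in ball (0 : EuclideanSpace ℝ (Fin 3)) 1, ‖u t x‖ ^ 2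
        ≤ C * (-t) ^ (-(2⁻¹ : ℝ)) * C := mul_le_mul_of_nonneg_left hA (by positivity)
      _ = C ^ 2 * (-t) ^ (-(2⁻¹ : ℝ)) := by ring
  calc ∫⁻ t in Ioo (-1 : ℝ) 0, ∫⁻ x in ball (0 : EuclideanSpace ℝ (Fin 3)) 1, ‖u t x‖ₑ ^ (3 : ℕ)
      ≤ ∫⁻ t in Ioo (-1 : ℝ) 0, ENNReal.ofReal (C ^ 2) * ENNReal.ofReal ((-t) ^ (-(2⁻¹ : ℝ))) :=
        setLIntegral_mono' measurableSet_Ioo hslice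
    _ = ENNReal.ofReal (C ^ 2) * ∫⁻ t in Ioo (-1 : ℝ) 0, ENNReal.ofReal ((-t) ^ (-(2⁻¹ : ℝ))) := by
        rw [lintegral_const_mul' _ _ ENNReal.ofReal_ne_top]
    _ ≤ ENNReal.ofReal (C ^ 2) * ENNReal.ofReal 2 := mul_le_mul_right lintegral_Ioo_rpow_neg_half_le _
    _ = ENNReal.ofReal (2 * C ^ 2) := by rw [← ENNReal.ofReal_mul (by positivity)]; ring_nf

/-- **`E(Q(0,1)) ≤ 3C`** for a class member, with `∇u := fderiv` (Frobenius ≤ 3 × operator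
norm; the time integral up to `t = 0` by monotone convergence from the balls `Q((tₙ,0),1)`,
`tₙ ↑ 0`, on each of which the scaled-dissipation clause is a genuine integral). [cite: AlbrittonBarker2019, §1] -/
theorem cknE_unit_le (hK : IsTypeIAncientMild C u)
    (h5 : ∀ (x₀ : EuclideanSpace ℝ (Fin 3)) (t₀ r : ℝ), t₀ ≤ 0 → 0 < r →
      (∀ t, t₀ - r ^ 2 < t → t < t₀ → r⁻¹ * ∫ x in ball x₀ r, ‖u t x‖ ^ 2 ≤ C) ∧
        r⁻¹ * ∫ t in Ioo (t₀ - r ^ 2) t₀, ∫ x in ball x₀ r, ‖fderiv ℝ (u t) x‖ ^ 2 ≤ C) :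
    cknE 1 0 (fun t x => fderiv ℝ (u t) x) ≤ ENNReal.ofReal (3 * C) := by
  have hC0 := hK.nonneg
  have hDu : ContinuousOn (fun z : ℝ × EuclideanSpace ℝ (Fin 3) => fderiv ℝ (u z.1) z.2)
      (Iio (0 : ℝ) ×ˢ univ) :=
    continuousOn_fderiv_slice_of_contDiffOn (hK.contDiffOn.of_le (by norm_cast))
      isOpen_Iio.uniqueDiffOn
  unfold cknE
  rw [ENNReal.ofReal_one, inv_one, one_mul]
  -- Frobenius ≤ 3 × operator norm, then Tonelli
  set g : ℝ × EuclideanSpace ℝ (Fin 3) → ℝ≥0∞ := fun w => ENNReal.ofReal (‖fderiv ℝ (u w.1) w.2‖ ^ 2)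
    with hg
  have hle : ∀ w : ℝ × EuclideanSpace ℝ (Fin 3),
      ENNReal.ofReal (frobeniusNormSq (fderiv ℝ (u w.1) w.2)) ≤ 3 * g w := fun w => by
    rw [hg, show (3 : ℝ≥0∞) = ENNReal.ofReal 3 by norm_num, ← ENNReal.ofReal_mul (by norm_num)]
    exact ENNReal.ofReal_le_ofReal (Literature.Analysis.FluidPDE.frobeniusNormSq_le_three_mul _)
  have hgm : AEMeasurable g (volume.restrict (parabolicCylinder 1 (0 : ℝ × EuclideanSpace ℝ (Fin 3)))) :=
    aemeasurable_parabolicCylinder_one_of_continuousOn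
      (ENNReal.continuous_ofReal.comp_continuousOn ((continuous_norm.comp_continuousOn hDu).pow 2))
  refine (lintegral_mono hle).trans ?_
  rw [lintegral_const_mul'' _ hgm, lintegral_parabolicCylinder_one_eq hgm]
  -- the local dissipation as a continuous function of time
  set G : ℝ → ℝ := fun t => ∫ x in ball (0 : EuclideanSpace ℝ (Fin 3)) 1, ‖fderiv ℝ (u t) x‖ ^ 2
    with hGdef
  have hGc : ContinuousOn G (Iio 0) :=
    continuousOn_setIntegral_ball_norm_sq_of_continuousOn (g := fun t x => fderiv ℝ (u t) x)
      isOpen_Iio hDu 0 1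
  have hG0 : ∀ t, 0 ≤ G t := fun t => setIntegral_nonneg measurableSet_ball fun _ _ => sq_nonneg _
  have hinner : ∀ t < 0, ∫⁻ x in ball (0 : EuclideanSpace ℝ (Fin 3)) 1, g (t, x) = ENNReal.ofReal (G t) := by
    intro t ht
    have hc : Continuous fun x => fderiv ℝ (u t) x := (hK.contDiff_slice ht).continuous_fderiv (by simp)
    have hint : IntegrableOn (fun x => ‖fderiv ℝ (u t) x‖ ^ 2) (ball (0 : EuclideanSpace ℝ (Fin 3)) 1)
        volume :=
      ((hc.norm.pow 2).continuousOn.integrableOn_compact (isCompact_closedBall 0 1)).mono_set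
        ball_subset_closedBall
    rw [hGdef, ofReal_integral_eq_lintegral_ofReal hint (ae_of_all _ fun _ => sq_nonneg _)]
  -- exhaust `(−1, 0)` by `(−1, tₙ)`, `tₙ = −1/(n+2)`
  set s : ℕ → ℝ := fun n => -((n : ℝ) + 2)⁻¹ with hs
  have hs0 : ∀ n, s n < 0 := fun n => by rw [hs]; exact neg_neg_of_pos (by positivity)
  have hs1 : ∀ n, -1 < s n := fun n => by
    rw [hs, neg_lt_neg_iff]
    exact inv_lt_one_of_one_lt₀ (by linarith [n.cast_nonneg (α := ℝ)])
  have hUnion : Ioo (-1 : ℝ) 0 = ⋃ n, Ioo (-1 : ℝ) (s n) := by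
    apply Subset.antisymm
    · intro t ht
      obtain ⟨n, hn⟩ := exists_nat_gt (-t)⁻¹
      refine mem_iUnion.2 ⟨n, ht.1, ?_⟩
      rw [hs]
      have ht0 : 0 < -t := by linarith [ht.2]
      have h1 : (-t)⁻¹ < (n : ℝ) + 2 := by linarith
      have := (inv_lt_comm₀ ht0 (by positivity)).1 h1
      linarith
    · exact iUnion_subset fun n => Ioo_subset_Ioo_right (hs0 n).le
  have hdir : Directed (· ⊆ ·) fun n => Ioo (-1 : ℝ) (s n) := by
    refine Monotone.directed_le fun m n hmn => Ioo_subset_Ioo_right ?_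
    rw [hs, neg_le_neg_iff]
    exact inv_anti₀ (by positivity) (by exact_mod_cast Nat.add_le_add_right hmn 2)
  rw [hUnion, setLIntegral_iUnion_of_directed _ hdir]
  have hsup : (⨆ n, ∫⁻ t in Ioo (-1 : ℝ) (s n), ∫⁻ x in ball (0 : EuclideanSpace ℝ (Fin 3)) 1, g (t, x)) ≤
      ENNReal.ofReal C := by
    refine iSup_le fun n => ?_
    -- on `(−1, tₙ)` the clause at the ball `Q((tₙ, 0), 1)` applies
    have hsub : Ioo (-1 : ℝ) (s n) ⊆ Ioo (s n - 1 ^ 2) (s n) := Ioo_subset_Ioo_left (by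
      rw [one_pow]; linarith [hs0 n])
    have hIio : Ioo (s n - 1 ^ 2) (s n) ⊆ Iio (0 : ℝ) := fun t ht => lt_trans ht.2 (hs0 n)
    have hIcc : Icc (s n - 1 ^ 2) (s n) ⊆ Iio (0 : ℝ) := fun t ht => lt_of_le_of_lt ht.2 (hs0 n)
    have hint : IntegrableOn G (Ioo (s n - 1 ^ 2) (s n)) volume :=
      ((hGc.mono hIcc).integrableOn_compact isCompact_Icc).mono_set Ioo_subset_Icc_self
    have hclause := (h5 0 (s n) 1 (hs0 n).le one_pos).2
    rw [inv_one, one_mul] at hclause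
    calc ∫⁻ t in Ioo (-1 : ℝ) (s n), ∫⁻ x in ball (0 : EuclideanSpace ℝ (Fin 3)) 1, g (t, x)
        ≤ ∫⁻ t in Ioo (s n - 1 ^ 2) (s n), ∫⁻ x in ball (0 : EuclideanSpace ℝ (Fin 3)) 1, g (t, x) :=
          lintegral_mono_set hsub
      _ = ∫⁻ t in Ioo (s n - 1 ^ 2) (s n), ENNReal.ofReal (G t) :=
          setLIntegral_congr_fun measurableSet_Ioo fun t ht => hinner t (hIio ht)
      _ = ENNReal.ofReal (∫ t in Ioo (s n - 1 ^ 2) (s n), G t) :=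
          (ofReal_integral_eq_lintegral_ofReal hint (ae_of_all _ hG0)).symm
      _ ≤ ENNReal.ofReal C := ENNReal.ofReal_le_ofReal hclause
  calc 3 * (⨆ n, ∫⁻ t in Ioo (-1 : ℝ) (s n), ∫⁻ x in ball (0 : EuclideanSpace ℝ (Fin 3)) 1, g (t, x))
      ≤ 3 * ENNReal.ofReal C := mul_le_mul_right hsup 3
    _ = ENNReal.ofReal (3 * C) := by
        rw [show (3 : ℝ≥0∞) = ENNReal.ofReal 3 by norm_num, ← ENNReal.ofReal_mul (by norm_num)]

end Summit.NavierStokesRegularity.NavierStokesRegularity.Theorems.SingularProfile
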